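import Mathlib
import Summits.Ventures.PercRepro2.Defs
import Summits.Ventures.PercRepro2.Graph
import Summits.Ventures.PercRepro2.DisagreementPinned
import Summits.Ventures.PercRepro2.TypedA3Inactive
import Summits.Ventures.PercRepro2.TypedSpectator
import Summits.Ventures.PercRepro2.TypedSwitchingPrimed
import Summits.Ventures.PercRepro2.TypedSignSpectator
import Summits.Ventures.PercRepro2.OneColourSwitch
import Summits.Ventures.PercRepro2.OneColourSwitchFibre
import Summits.Ventures.PercRepro2.M9PendantFibreSign

/-!
# `m9` in the typed calculus for pendant `r, s` (blind cell PercRepro2, p3 g15, 2026-08-27;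
`proofs/P3-CPNC.md` §11)

The first class theorem of the switching move `m9` in the crux's own vocabulary: for the REAL
connectivity state map `connState ends p q r s` (typer-1 g44's `TypedSignSpectator`), every typed
triple count `typedCount F z τ (kerSign (connState …) g)` with `g ≥ 0`, types in `{1, 2}` on `F`,
and `r, s` pendant with their single edges of type 1 in `F`, is `≤ 0` — hence `m9` holds on
`(F, z, τ)` (`typedCount_m9_iff_sign`).  Proof: the bridge `typedCount_kerSign_nonpos_of_fibres`
reduces it to the spectator fibres; on a fibre where both pendant edges are single the sum is
`m9SignSumF`, which is `≤ 0` by `m9SignSumF_nonpos_of_pendant`; on a fibre where a pendant edge is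
absent (type 1 and open in the spectator) the mark is isolated in both colours and the sum is `0`.
Own work on the cell's chain; standard axioms.
-/

namespace Summit.Ventures.PercRepro2

namespace OneColourSwitch

open Finset Classical CovForm.PairHarris CovForm.TypedA3

variable {V : Type*} {E : Type*}
variable (ends : E → Sym2 V)

section Bridge

variable [Fintype E] [DecidableEq E]

omit ends [Fintype E] in
/-- The Set-indexed fibre flip of `OneColourSwitch` is the Finset-indexed `flipOn` of
`DisagreementPinned` on a coerced Finset. -/
lemma flipOn_coe (G : Finset E) (ω : Config E) :
    OneColourSwitch.flipOn (↑G : Set E) ω = Summit.Ventures.PercRepro2.flipOn G ω := by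
  funext e
  by_cases h : e ∈ G
  · rw [OneColourSwitch.flipOn_of_mem (Finset.mem_coe.2 h), Summit.Ventures.PercRepro2.flipOn_of_mem G ω h]
  · rw [OneColourSwitch.flipOn_of_notMem (fun h' => h (Finset.mem_coe.1 h')),
      Summit.Ventures.PercRepro2.flipOn_of_notMem G ω h]

variable {R : Type*} [Field R] [LinearOrder R] [IsStrictOrderedRing R]

omit [LinearOrder R] [IsStrictOrderedRing R] in
/-- The fibre sum of the typed bridge, in `R`, is the cast of the weight-free `m9SignSumF`. -/
lemma bridge_fibre_sum_eq_cast (G : Finset E) (b : Config E) (p q r s : V) :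
    (∑ ω : Config E,
        if (∀ e, e ∉ G → ω e = b e) ∧
            (¬ Conn ends ω p r ∧ ¬ Conn ends ω p s ∧ ¬ Conn ends ω q r ∧ ¬ Conn ends ω q s) ∧
            (¬ Conn ends (Summit.Ventures.PercRepro2.flipOn G ω) p r ∧
              ¬ Conn ends (Summit.Ventures.PercRepro2.flipOn G ω) p s ∧
              ¬ Conn ends (Summit.Ventures.PercRepro2.flipOn G ω) q r ∧
              ¬ Conn ends (Summit.Ventures.PercRepro2.flipOn G ω) q s)
          then ((if Conn ends ω p q then (1 : R) else 0) -
                (if Conn ends (Summit.Ventures.PercRepro2.flipOn G ω) p q then (1 : R) else 0)) *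
              ((if Conn ends ω r s then (1 : R) else 0) -
                (if Conn ends (Summit.Ventures.PercRepro2.flipOn G ω) r s then (1 : R) else 0))
          else 0) =
      ((m9SignSumF ends (↑G : Set E) b p q r s : ℤ) : R) := by
  unfold m9SignSumF
  rw [Int.cast_sum]
  refine Finset.sum_congr rfl fun ω _ => ?_
  have hfib : (ω ∈ fibre (↑G : Set E) b) ↔ (∀ e, e ∉ G → ω e = b e) := by
    simp only [fibre, Set.mem_setOf_eq, Finset.mem_coe]
  have hsep : sep2F ends (↑G : Set E) p q r s ω ↔
      (¬ Conn ends ω p r ∧ ¬ Conn ends ω p s ∧ ¬ Conn ends ω q r ∧ ¬ Conn ends ω q s) ∧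
        (¬ Conn ends (Summit.Ventures.PercRepro2.flipOn G ω) p r ∧
          ¬ Conn ends (Summit.Ventures.PercRepro2.flipOn G ω) p s ∧
          ¬ Conn ends (Summit.Ventures.PercRepro2.flipOn G ω) q r ∧
          ¬ Conn ends (Summit.Ventures.PercRepro2.flipOn G ω) q s) := by
    simp only [sep2F, sepY, flipOn_coe]
  by_cases h : (∀ e, e ∉ G → ω e = b e) ∧
      (¬ Conn ends ω p r ∧ ¬ Conn ends ω p s ∧ ¬ Conn ends ω q r ∧ ¬ Conn ends ω q s) ∧
      (¬ Conn ends (Summit.Ventures.PercRepro2.flipOn G ω) p r ∧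
        ¬ Conn ends (Summit.Ventures.PercRepro2.flipOn G ω) p s ∧
        ¬ Conn ends (Summit.Ventures.PercRepro2.flipOn G ω) q r ∧
        ¬ Conn ends (Summit.Ventures.PercRepro2.flipOn G ω) q s)
  · have h' : ω ∈ fibre (↑G : Set E) b ∧ sep2F ends (↑G : Set E) p q r s ω :=
      ⟨hfib.2 h.1, hsep.2 h.2⟩
    rw [if_pos h, if_pos h']
    simp only [sigmaF, flipOn_coe]
    push_cast
    ring
  · have h' : ¬ (ω ∈ fibre (↑G : Set E) b ∧ sep2F ends (↑G : Set E) p q r s ω) :=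
      fun h'' => h ⟨hfib.1 h''.1, hsep.1 h''.2⟩
    rw [if_neg h, if_neg h']
    simp

/-- On a fibre where the single edge of a pendant mark `r` is absent (closed in the base and not
free), `r` is isolated in both colours and the fibre sign sum vanishes. -/
lemma m9SignSumF_eq_zero_of_absent (G : Set E) (b : Config E) {p q r s : V} {e₁ : E}
    (hr : Pendant ends r e₁) (hG : e₁ ∉ G) (hb : b e₁ = false) (hrs : r ≠ s) :
    m9SignSumF ends G b p q r s = 0 := by
  unfold m9SignSumF
  refine Finset.sum_eq_zero fun ω _ => ?_
  by_cases h : ω ∈ fibre G b ∧ sep2F ends G p q r s ω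
  · rw [if_pos h]
    have hω : ω e₁ = false := by rw [h.1 e₁ hG]; exact hb
    have hno : ∀ e, r ∈ ends e → ω e = false := fun e he => by rw [hr.1 e he]; exact hω
    have hno' : ∀ e, r ∈ ends e → OneColourSwitch.flipOn G ω e = false := fun e he => by
      rw [hr.1 e he, OneColourSwitch.flipOn_of_notMem hG]; exact hω
    have h1 : ¬ Conn ends ω r s := fun hc => hrs (eq_of_conn_of_no_openEdge hno (conn_symm hc)).symm
    have h2 : ¬ Conn ends (OneColourSwitch.flipOn G ω) r s :=
      fun hc => hrs (eq_of_conn_of_no_openEdge hno' (conn_symm hc)).symm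
    simp [sigmaF, h1, h2]
  · rw [if_neg h]

/-- The mirror: an absent pendant edge of `s`. -/
lemma m9SignSumF_eq_zero_of_absent' (G : Set E) (b : Config E) {p q r s : V} {e₂ : E}
    (hs : Pendant ends s e₂) (hG : e₂ ∉ G) (hb : b e₂ = false) (hrs : r ≠ s) :
    m9SignSumF ends G b p q r s = 0 := by
  unfold m9SignSumF
  refine Finset.sum_eq_zero fun ω _ => ?_
  by_cases h : ω ∈ fibre G b ∧ sep2F ends G p q r s ω
  · rw [if_pos h]
    have hω : ω e₂ = false := by rw [h.1 e₂ hG]; exact hb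
    have hno : ∀ e, s ∈ ends e → ω e = false := fun e he => by rw [hs.1 e he]; exact hω
    have hno' : ∀ e, s ∈ ends e → OneColourSwitch.flipOn G ω e = false := fun e he => by
      rw [hs.1 e he, OneColourSwitch.flipOn_of_notMem hG]; exact hω
    have h1 : ¬ Conn ends ω r s := fun hc => hrs (eq_of_conn_of_no_openEdge hno hc)
    have h2 : ¬ Conn ends (OneColourSwitch.flipOn G ω) r s :=
      fun hc => hrs (eq_of_conn_of_no_openEdge hno' hc)
    simp [sigmaF, h1, h2]
  · rw [if_neg h]

/-- **`m9` in the typed calculus for pendant `r, s`** (the real state map `connState`; types in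
`{1, 2}` on `F`; the pendant edges of type 1 in `F`; `g ≥ 0`): the typed sign count is `≤ 0`. -/
theorem typedCount_kerSign_connState_nonpos_of_pendant (F : Finset E) (z : Config E) (τ : E → ℕ)
    (hτ : ∀ e ∈ F, τ e = 1 ∨ τ e = 2) (g : St6 → R) (hg : ∀ t, 0 ≤ g t) {p q r s : V} {e₁ e₂ : E}
    (hr : Pendant ends r e₁) (hs : Pendant ends s e₂) (h₁ : e₁ ∈ F) (h₂ : e₂ ∈ F)
    (hτ₁ : τ e₁ = 1) (hτ₂ : τ e₂ = 1) (hpr : p ≠ r) (hps : p ≠ s) (hqr : q ≠ r) (hqs : q ≠ s)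
    (hrs : r ≠ s) :
    typedCount F z τ (kerSign (connState ends p q r s) g) ≤ 0 := by
  apply typedCount_kerSign_nonpos_of_fibres F z τ hτ _ g hg
  intro x hx
  rw [pinnedCount_signKer_connState, bridge_fibre_sum_eq_cast]
  have hpin : ∀ e ∈ F, τ e = 1 → specPin F z τ x e = false := fun e he hτe => by
    rw [specPin_of_mem he, hτe]
    exact decide_eq_false (by omega)
  by_cases hG₁ : e₁ ∈ specFree F τ x
  · by_cases hG₂ : e₂ ∈ specFree F τ x
    · have := m9SignSumF_nonpos_of_pendant (ends := ends) (↑(specFree F τ x) : Set E)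
        (specPin F z τ x) hr hs (Finset.mem_coe.2 hG₁) (Finset.mem_coe.2 hG₂) hpr hps hqr hqs hrs
      exact_mod_cast this
    · rw [m9SignSumF_eq_zero_of_absent' ends _ _ hs (fun h => hG₂ (Finset.mem_coe.1 h))
        (hpin e₂ h₂ hτ₂) hrs]
      simp
  · rw [m9SignSumF_eq_zero_of_absent ends _ _ hr (fun h => hG₁ (Finset.mem_coe.1 h))
      (hpin e₁ h₁ hτ₁) hrs]
    simp

/-- **The move `m9` itself on `(F, z, τ)` for pendant `r, s`**:
`c(pq|rs, SEP) ≤ c(pq|r|s, rs|p|q)` for the real state map. -/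
theorem typedCount_m9_connState_of_pendant (F : Finset E) (z : Config E) (τ : E → ℕ)
    (hτ : ∀ e ∈ F, τ e = 1 ∨ τ e = 2) (g : St6 → R) (hg : ∀ t, 0 ≤ g t) {p q r s : V} {e₁ e₂ : E}
    (hr : Pendant ends r e₁) (hs : Pendant ends s e₂) (h₁ : e₁ ∈ F) (h₂ : e₂ ∈ F)
    (hτ₁ : τ e₁ = 1) (hτ₂ : τ e₂ = 1) (hpr : p ≠ r) (hps : p ≠ s) (hqr : q ≠ r) (hqs : q ≠ s)
    (hrs : r ≠ s) :
    typedCount F z τ (kerM9Src (connState ends p q r s) g) ≤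
      typedCount F z τ (kerM9Tgt (connState ends p q r s) g) :=
  (typedCount_m9_iff_sign F z τ _ g).2
    (typedCount_kerSign_connState_nonpos_of_pendant ends F z τ hτ g hg hr hs h₁ h₂ hτ₁ hτ₂ hpr hps
      hqr hqs hrs)

end Bridge

/-! ## The mirror: pendant `p, q` (the typed kernel is symmetric in the two pairs up to the bit swap) -/

section Mirror

variable [Fintype E] [DecidableEq E] {R : Type*} [Field R] [LinearOrder R] [IsStrictOrderedRing R]

omit [Fintype E] [DecidableEq E] [LinearOrder R] [IsStrictOrderedRing R] in
/-- The pair swap on the six bits: `(pq, pr, ps, qr, qs, rs) ↦ (rs, pr, qr, ps, qs, pq)`. -/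
def swapPairs (t : St6) : St6 := (t.2.2.2.2.2, t.2.1, t.2.2.2.1, t.2.2.1, t.2.2.2.2.1, t.1)

omit [Fintype E] [DecidableEq E] [LinearOrder R] [IsStrictOrderedRing R] in
/-- `swapPairs` is an involution. -/
lemma swapPairs_swapPairs (t : St6) : swapPairs (swapPairs t) = t := by
  rcases t with ⟨a, b, c, d, e, f⟩; rfl

omit [Fintype E] [DecidableEq E] [LinearOrder R] [IsStrictOrderedRing R] in
/-- The separation bit is invariant under the pair swap. -/
lemma sepSt_swapPairs (t : St6) : sepSt (swapPairs t) = sepSt t := by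
  rcases t with ⟨a, b, c, d, e, f⟩
  cases b <;> cases c <;> cases d <;> cases e <;> rfl

omit [Fintype E] [DecidableEq E] [LinearOrder R] [IsStrictOrderedRing R] in
/-- The state map of the swapped pairs is the swap of the state map. -/
lemma connState_swap {p q r s : V} (ω : Config E) :
    connState ends r s p q ω = swapPairs (connState ends p q r s ω) := by
  have e1 : decide (Conn ends ω r p) = decide (Conn ends ω p r) := by
    simp only [decide_eq_decide]; exact ⟨conn_symm, conn_symm⟩
  have e2 : decide (Conn ends ω r q) = decide (Conn ends ω q r) := by
    simp only [decide_eq_decide]; exact ⟨conn_symm, conn_symm⟩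
  have e3 : decide (Conn ends ω s p) = decide (Conn ends ω p s) := by
    simp only [decide_eq_decide]; exact ⟨conn_symm, conn_symm⟩
  have e4 : decide (Conn ends ω s q) = decide (Conn ends ω q s) := by
    simp only [decide_eq_decide]; exact ⟨conn_symm, conn_symm⟩
  show (decide (Conn ends ω r s), decide (Conn ends ω r p), decide (Conn ends ω r q),
      decide (Conn ends ω s p), decide (Conn ends ω s q), decide (Conn ends ω p q)) =
    (decide (Conn ends ω r s), decide (Conn ends ω p r), decide (Conn ends ω q r),
      decide (Conn ends ω p s), decide (Conn ends ω q s), decide (Conn ends ω p q))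
  rw [e1, e2, e3, e4]

omit [Fintype E] [DecidableEq E] [LinearOrder R] [IsStrictOrderedRing R] in
/-- The sign kernel of the swapped pairs is the sign kernel of the original pairs with the
spectator weight transported by the swap. -/
lemma kerSign_connState_swap {p q r s : V} (g : St6 → R) (x y w : Config E) :
    kerSign (connState ends r s p q) g x y w =
      kerSign (connState ends p q r s) (g ∘ swapPairs) x y w := by
  have h1 : ∀ t : St6, pqSt (swapPairs t) = rsSt t := fun t => rfl
  have h2 : ∀ t : St6, rsSt (swapPairs t) = pqSt t := fun t => rfl
  simp only [kerSign, connState_swap (ends := ends) (p := p) (q := q) (r := r) (s := s),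
    sepSt_swapPairs, h1, h2, Function.comp]
  ring

/-- **`m9` in the typed calculus for pendant `p, q`** (the mirror of
`typedCount_m9_connState_of_pendant`). -/
theorem typedCount_m9_connState_of_pendant' (F : Finset E) (z : Config E) (τ : E → ℕ)
    (hτ : ∀ e ∈ F, τ e = 1 ∨ τ e = 2) (g : St6 → R) (hg : ∀ t, 0 ≤ g t) {p q r s : V}
    {e₁ e₂ : E} (hp : Pendant ends p e₁) (hq : Pendant ends q e₂) (h₁ : e₁ ∈ F) (h₂ : e₂ ∈ F)
    (hτ₁ : τ e₁ = 1) (hτ₂ : τ e₂ = 1) (hrp : r ≠ p) (hrq : r ≠ q) (hsp : s ≠ p) (hsq : s ≠ q)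
    (hpq : p ≠ q) :
    typedCount F z τ (kerM9Src (connState ends p q r s) g) ≤
      typedCount F z τ (kerM9Tgt (connState ends p q r s) g) := by
  apply (typedCount_m9_iff_sign F z τ _ g).2
  have hg' : ∀ t, 0 ≤ (g ∘ swapPairs) t := fun t => hg _
  have key := typedCount_kerSign_connState_nonpos_of_pendant ends F z τ hτ (g ∘ swapPairs) hg'
    (p := r) (q := s) (r := p) (s := q) hp hq h₁ h₂ hτ₁ hτ₂ hrp hrq hsp hsq hpq
  rw [typedCount_congr' F z τ _ _ (fun x y w =>
    kerSign_connState_swap (ends := ends) (p := p) (q := q) (r := r) (s := s)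
      (g ∘ swapPairs) x y w)] at key
  have hinv : (g ∘ swapPairs) ∘ swapPairs = g := by
    funext t; simp [Function.comp, swapPairs_swapPairs]
  rw [hinv] at key
  exact key

end Mirror

end OneColourSwitch

end Summit.Ventures.PercRepro2
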